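import Summits.HodgeConjecture.HodgeConjecture.Theorems.VHCAbelianSchemesRoadSecantQuotientAnchorPinnedTransferDefs
import HarnessLib

/-!
# Road b02 (`VHCAbelianSchemesRoad`, D-0059) — THE G1 NODE, TYPED: «SAME-LEVEL TRANSFER OF CARRIED-NESS ACROSS PINNED ANCHORS»
# (`SecantQuotientAnchorLevelTransfer63 𝒪`), the lane-R half of the ∀-node behind stub 2a‴ of crux `SemiregularSheafRepresentativesTwPrimeAtDiag`
# (item stmt-HodgeConjecture-20707, skeleton v3.3), so that ring2-b03x's node = G1 ∧ G3 (definitions and fact-free glue only)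

research route conditional on HC_CM; not a corollary; Q11.4-sentence-2 already refuted in dim ≥ 3.

DEFINITIONS AND FACT-FREE GLUE ONLY (`HC_CM` nowhere; nothing asserted). Director-hodge g10 RULING R10.4 (2) (HOME INBOX 2026-08-27T19:16Z): after the S1
design census (evidence n°17 on the item) the residual lane R is RE-POINTED to gap (G1) of ring2-b03x g2's node `SecantQuotientWeilDirectionTransfer63 𝒪`
(`VHCAbelianSchemesRoadSecantQuotientAnchorPinnedTransferDefs`, p556635), lane W1 keeping (G3); FIRST DELIVERABLE = the G1 node TYPED as ONE named
∀-statement over the anchors of one level. ring2-b03x's node quantifies over TWO pinned anchors of a level AND two directions at once; it is the conjunction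
of two cleanly separated statements:

* (G1) `SecantQuotientAnchorLevelTransfer63 𝒪` (THIS FILE, lane R): for every level `d` and all level-`d` secant–quotient anchors WITH THEIR CLASS
  `(X, θ)`, `(X', θ')` (`Markman2025.IsSecantQuotientAnchorWith d`): **if SOME rational pinned-served class is `𝒪`-carried at `(X', θ')`, then SOME rational
  pinned-served class is `𝒪`-carried at `(X, θ)`** — carried-ness of a pinned-served direction TRAVELS ACROSS THE ANCHORS OF ONE LEVEL (other genus-3
  curves — hyperelliptic ones included —, other admissible level structures `(G₁, G₂)`, other charts `e`, other pins `θ₀`);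
* (G3) (lane W1; displayed here INLINE, not named — ring2-b03x's to name): at ONE pinned anchor, one carried rational pinned-served direction carries every
  rational pinned-served direction (the `P¹(ℚ)`-worth of the descended Weil plane off the `θ³`-ray; ring2-b03x's `SecantQuotientWeilDirectionTransfer63.sameAnchor`
  is the node's specialisation to it);

and §2 proves, fact-free: **G1 ∧ G3 ⟹ node** (`weilDirectionTransfer63_of_levelTransfer_of_sameAnchor`); **node ⟹ G1** at every anchor that HAS a rational
pinned-served class (`levelTransfer63_of_weilDirectionTransfer63`; the node gives G3 outright, b03x); the primed instances for `tw C AdmTw′`; and the stub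
junction **L1″(C, AdmTw′) ∧ G1′ ∧ G3′ ⟹ `SecantQuotientAnchorCarrier63PinnedPrime C`** by ring2-b03x's glue BY NAME.

PAPER DESIGN OF G1 (why typed so; why not in print; why it might fail). Across the anchors of one level the pinned anchors `(J(C) × Ĵ(C))/Ḡ` form ONE
connected family over the level-`(d+1)` moduli of genus-3 curves with the two cyclic subgroups; the door's own mechanism (a semiregular `B`-twisted object
whose `κ₃` stays Hodge DEFORMS sideways: Buchweitz–Flenner 5.1, Pridham 2.25, Markman Thm. 1.5.1) makes carried-ness an OPEN condition along that family,
so G1 HOLDS GENERICALLY for free once ONE anchor of the level is carried (print's seed: L1″) — its entire content is CLOSEDNESS: carried-ness at EVERY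
anchor of the level, i.e. at the SPECIAL members where the deformed object may stop being admissible: hyperelliptic curves (Markman assumes
non-hyperelliptic, p. 6 ∕ p. 43 ∕ p. 57; Prop. 9.2.2's reflexivity of rank `8d` may fail), special level structures, and — one step further, outside the
pinned envelope as typed — the compact-type degenerations `J(C) → E³` where lane R's census found the class-level shape `κ = r + a·w` realised by 32
integral roots (evidence n°17 (D4); R10.4 (3): G1 backlog item №1). The ∃-direction form is deliberate: which direction is carried at the special anchor is
G3's business, not G1's; and G1 in ∃-form is implied by the node only where a rational pinned-served class exists (displayed hypothesis in §2; every
anchor of the envelope has one — the descended Weil plane is a rational plane off the ray —, but that existence lemma is not in the tree today).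
WHY IT MIGHT FAIL: limits of semiregular sheaves need not be semiregular; at a hyperelliptic anchor the secant construction changes (the secant variety of a
hyperelliptic canonical curve is degenerate); finite monodromy of the Weil local system does not help at a fixed special fibre. OPEN; a HYPOTHESIS wherever
used. FIRST HONEST SPECIAL CASE (next, paper first): the open part — «carried at one anchor ⟹ carried on a Zariski-dense open set of anchors of the level» —
is the door's deformation statement read along the level family and should be typable from `TwistedPerfectDoorPrime` once the level family is a typed
one-parameter object; the closed complement is the research content.

Nothing here says G1, G3, the node, L1″, any stub ∕ cell ∕ rung ∕ crux, K-SR♭∃, VHC, `HC_AV`, `HC_CM` or HC holds.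
References: [cite: Markman2025SecantWeil, §1.3 (p. 5), §1.5 (p. 7), Thm. 1.4.1 (item 4), Thm. 1.5.1, §9.2 Prop. 9.2.2] [cite: BuchweitzFlenner2003, §5 Thm. 5.1]
[cite: Pridham2024Semiregularity, Cor. 2.25 and Rem. 2.26] [cite: Bloch1972Semiregularity, Remark (7.5)] [cite: vanGeemen1994HodgeAV, Lemma 5.2, 5.3–5.5 and Thm. 4.11]
[cite: MoonenZarhin1998WeilClasses, §1].
-/

noncomputable section

open CategoryTheory CategoryTheory.Limits AlgebraicGeometry Topology

namespace Summit.HodgeConjecture.HodgeConjecture.Ring2.SemiregularRepresentatives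

set_option linter.dupNamespace false -- the cell's namespace repeats the summit name, as in every `Ring2*` file

open Literature.AlgebraicGeometry Literature.AlgebraicGeometry.Motives Literature.AlgebraicGeometry.Motives.AbelianVariety
open Literature.AlgebraicGeometry.HodgeTheory Literature.AlgebraicGeometry.Markman2025
open Literature.AlgebraicTopology.SingularHomology
open Summit.Ventures.HSemireg (ObjClass)
open Summit.HodgeConjecture.HodgeConjecture.Ring2.AbelianAll (carriedClasses)

/-! ## §1 The G1 node -/

/-- **G1 — SAME-LEVEL TRANSFER OF CARRIED-NESS ACROSS PINNED ANCHORS at `(6,3)` (`SecantQuotientAnchorLevelTransfer63 𝒪`)**: for every level `d` and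
all complex schemes `X`, `X'` with degree-2 classes `θ`, `θ'` exhibiting them as level-`d` secant–quotient anchors WITH THEIR CLASS
(`Markman2025.IsSecantQuotientAnchorWith d`: `X ≅ (J × Ĵ)/Ḡ`, `θ = e^*h_Y(θ₀)`), **if some rational pinned-served class `w' ∈ 𝔖^pin X' θ'` is carried by an
`𝒪`-datum at `(X', θ')` (`w' ∈ AbelianAll.carriedClasses 𝒪 6 3 X' θ'`), then some rational pinned-served class `w ∈ 𝔖^pin X θ` is carried by an `𝒪`-datum
at `(X, θ)`**. The lane-R half (gap (G1): other curves, level structures, charts, pins) of ring2-b03x's node `SecantQuotientWeilDirectionTransfer63 𝒪`,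
which is G1 ∧ G3 (§2). Content = CLOSEDNESS of carried-ness along the connected level family (generic transfer is the door's deformation mechanism); NOT IN
PRINT (Markman's anchors are generic non-hyperelliptic curves; Prop. 9.2.2 may fail at special curves); WHY IT MIGHT FAIL: limits of admissible objects
need not be admissible. OPEN; a HYPOTHESIS wherever used. [cite: Markman2025SecantWeil, §1.5 (p. 7), Thm. 1.4.1 (item 4), Thm. 1.5.1 and §9.2 Prop. 9.2.2]
[cite: BuchweitzFlenner2003, §5 Thm. 5.1] [cite: Bloch1972Semiregularity, Remark (7.5)] [status: open] -/
@[conjecture] def SecantQuotientAnchorLevelTransfer63 (𝒪 : ObjClass) : Prop :=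
  ∀ (d : ℕ) ⦃X X' : SchemeOver ℂ⦄ ⦃θ : complexBetti X 2⦄ ⦃θ' : complexBetti X' 2⦄,
    IsSecantQuotientAnchorWith d X θ → IsSecantQuotientAnchorWith d X' θ' →
    (∃ w' : complexBetti X' (2 * 3), w' ∈ secantQuotientServedClassesPinned X' θ' ∧ IsRationalClass w' ∧ w' ∈ carriedClasses 𝒪 6 3 X' θ') →
    ∃ w : complexBetti X (2 * 3), w ∈ secantQuotientServedClassesPinned X θ ∧ IsRationalClass w ∧ w ∈ carriedClasses 𝒪 6 3 X θ

/-- **G1 for the PRIMED twisted door `tw C AdmTw′`**, `AdmTw′ := gluableSigmaAdmissible ∨ bfSingleAdmissible′` — the reading that feeds stub 2a‴ of skeleton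
v3.3 (item stmt-HodgeConjecture-20707) through §2. OPEN; a HYPOTHESIS wherever used. [cite: Markman2025SecantWeil, Thm. 1.4.1 (item 4), §1.5 and §9.3 Lemma 9.3.11]
[cite: BuchweitzFlenner2003, §5 Thm. 5.1] [cite: Pridham2024Semiregularity, Cor. 2.25 and Rem. 2.26] [status: open] -/
@[conjecture] def SecantQuotientAnchorLevelTransfer63PinnedPrime (C : ChernCharacterBetti) : Prop :=
  SecantQuotientAnchorLevelTransfer63 (Literature.AlgebraicGeometry.HodgeTheory.twistedReflexiveClass C
    (fun n X₀ I E => Summit.Ventures.HSemireg.gluableSigmaAdmissible n X₀ I E ∨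
      Literature.AlgebraicGeometry.HodgeTheory.bfSingleAdmissible' n X₀ I E))

variable {𝒪 : ObjClass} {C : ChernCharacterBetti}

/-- The primed G1 node, unfolded (definitional). [cite: Markman2025SecantWeil, Thm. 1.4.1] -/
theorem secantQuotientAnchorLevelTransfer63PinnedPrime_iff :
    SecantQuotientAnchorLevelTransfer63PinnedPrime C ↔
      SecantQuotientAnchorLevelTransfer63 (Literature.AlgebraicGeometry.HodgeTheory.twistedReflexiveClass C
        (fun n X₀ I E => Summit.Ventures.HSemireg.gluableSigmaAdmissible n X₀ I E ∨
          Literature.AlgebraicGeometry.HodgeTheory.bfSingleAdmissible' n X₀ I E)) :=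
  Iff.rfl

/-! ## §2 Fact-free glue: node = G1 ∧ G3 -/

/-- **G1 ∧ G3 ⟹ ring2-b03x's node.** With G3 DISPLAYED (lane W1's statement, spelled inline: at one level-`d` pinned anchor, one carried rational pinned-served
direction carries every rational pinned-served direction), the level transfer G1 gives `SecantQuotientWeilDirectionTransfer63 𝒪`: transfer SOME carried
direction from `(X', θ')` to `(X, θ)` by G1, then reach the prescribed `w` inside `(X, θ)` by G3. [cite: Markman2025SecantWeil, Thm. 1.4.1 (item 4) and Thm. 1.5.1]
[cite: Bloch1972Semiregularity, Remark (7.5)] -/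
theorem weilDirectionTransfer63_of_levelTransfer_of_sameAnchor (hG1 : SecantQuotientAnchorLevelTransfer63 𝒪)
    (hG3 : ∀ (d : ℕ) ⦃X : SchemeOver ℂ⦄ ⦃θ : complexBetti X 2⦄ ⦃w w' : complexBetti X (2 * 3)⦄,
      IsSecantQuotientAnchorWith d X θ → w ∈ secantQuotientServedClassesPinned X θ → IsRationalClass w →
      w' ∈ secantQuotientServedClassesPinned X θ → IsRationalClass w' → w' ∈ carriedClasses 𝒪 6 3 X θ →
      w ∈ carriedClasses 𝒪 6 3 X θ) :
    SecantQuotientWeilDirectionTransfer63 𝒪 := by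
  intro d X X' θ θ' w w' hX hw hwQ hX' hw' hw'Q hc
  obtain ⟨w₀, hw₀, hw₀Q, hc₀⟩ := hG1 d hX hX' ⟨w', hw', hw'Q, hc⟩
  exact hG3 d hX hw hwQ hw₀ hw₀Q hc₀

/-- **The node ⟹ G1** at every target anchor possessing a rational pinned-served class (displayed; every anchor of the envelope has one, the descended
Weil plane being a rational plane off the ray — existence lemma not in the tree today). [cite: Markman2025SecantWeil, Thm. 1.4.1 (item 4) and §1.5]
[cite: MoonenZarhin1998WeilClasses, §1] -/
theorem levelTransfer63_of_weilDirectionTransfer63 (hN : SecantQuotientWeilDirectionTransfer63 𝒪)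
    (hne : ∀ (d : ℕ) ⦃X : SchemeOver ℂ⦄ ⦃θ : complexBetti X 2⦄, IsSecantQuotientAnchorWith d X θ →
      ∃ w : complexBetti X (2 * 3), w ∈ secantQuotientServedClassesPinned X θ ∧ IsRationalClass w) :
    SecantQuotientAnchorLevelTransfer63 𝒪 := by
  intro d X X' θ θ' hX hX' ⟨w', hw', hw'Q, hc⟩
  obtain ⟨w, hw, hwQ⟩ := hne d hX
  exact ⟨w, hw, hwQ, hN d hX hw hwQ hX' hw' hw'Q hc⟩

/-- **The node ⟹ G3** is ring2-b03x's `SecantQuotientWeilDirectionTransfer63.sameAnchor`; recorded here in the displayed shape used above, so that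
«node ⟺ G1 ∧ G3» reads off this file (modulo the existence of a rational pinned-served class at each anchor for ⟹ G1).
[cite: Markman2025SecantWeil, Thm. 1.4.1 (item 4)] -/
theorem sameAnchorTransfer63_of_weilDirectionTransfer63 (hN : SecantQuotientWeilDirectionTransfer63 𝒪) :
    ∀ (d : ℕ) ⦃X : SchemeOver ℂ⦄ ⦃θ : complexBetti X 2⦄ ⦃w w' : complexBetti X (2 * 3)⦄,
      IsSecantQuotientAnchorWith d X θ → w ∈ secantQuotientServedClassesPinned X θ → IsRationalClass w →
      w' ∈ secantQuotientServedClassesPinned X θ → IsRationalClass w' → w' ∈ carriedClasses 𝒪 6 3 X θ →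
      w ∈ carriedClasses 𝒪 6 3 X θ :=
  fun _ _ _ _ _ hX hw hwQ hw' hw'Q hc ↦ hN.sameAnchor hX hw hwQ hw' hw'Q hc

/-- **STUB 2a‴ FROM PRINT, G1 AND G3: `L1″(C, AdmTw′) ∧ G1′ ∧ G3′ ⟹ SecantQuotientAnchorCarrier63PinnedPrime C`** — ring2-b03x's junction
`secantQuotientAnchorCarrier63PinnedPrime_of_pinned_of_weilDirectionTransfer` with the node assembled from the two lanes' halves. Nothing here says any
input holds. [cite: Markman2025SecantWeil, Thm. 1.4.1 (item 4), §1.5, Thm. 1.5.1 and Lemma 9.3.11] [cite: Bloch1972Semiregularity, Remark (7.5)]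
[cite: BuchweitzFlenner2003, §5 Thm. 5.1] -/
theorem secantQuotientAnchorCarrier63PinnedPrime_of_pinned_of_levelTransfer_of_sameAnchor
    (hM : Markman2025_secantQuotient_twistedCarrier_onJacobian_pinned C
      (fun n X₀ I E => Summit.Ventures.HSemireg.gluableSigmaAdmissible n X₀ I E ∨
        Literature.AlgebraicGeometry.HodgeTheory.bfSingleAdmissible' n X₀ I E))
    (hG1 : SecantQuotientAnchorLevelTransfer63PinnedPrime C)
    (hG3 : ∀ (d : ℕ) ⦃X : SchemeOver ℂ⦄ ⦃θ : complexBetti X 2⦄ ⦃w w' : complexBetti X (2 * 3)⦄,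
      IsSecantQuotientAnchorWith d X θ → w ∈ secantQuotientServedClassesPinned X θ → IsRationalClass w →
      w' ∈ secantQuotientServedClassesPinned X θ → IsRationalClass w' →
      w' ∈ carriedClasses (Literature.AlgebraicGeometry.HodgeTheory.twistedReflexiveClass C
        (fun n X₀ I E => Summit.Ventures.HSemireg.gluableSigmaAdmissible n X₀ I E ∨
          Literature.AlgebraicGeometry.HodgeTheory.bfSingleAdmissible' n X₀ I E)) 6 3 X θ →
      w ∈ carriedClasses (Literature.AlgebraicGeometry.HodgeTheory.twistedReflexiveClass C
        (fun n X₀ I E => Summit.Ventures.HSemireg.gluableSigmaAdmissible n X₀ I E ∨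
          Literature.AlgebraicGeometry.HodgeTheory.bfSingleAdmissible' n X₀ I E)) 6 3 X θ) :
    SecantQuotientAnchorCarrier63PinnedPrime C :=
  secantQuotientAnchorCarrier63PinnedPrime_of_pinned_of_weilDirectionTransfer hM
    (weilDirectionTransfer63_of_levelTransfer_of_sameAnchor hG1 hG3)

end Summit.HodgeConjecture.HodgeConjecture.Ring2.SemiregularRepresentatives

end
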